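import Summits.PneNP.PneNP.Theorems.PseudorandomTwinsAbove.Negative.VertexEscape
import Literature.Computability.Complexity.CoinCounting

/-!
# Glue `PseudorandomTwinsImplyTarget` (stmt-PneNP-2723), part 2: octaves, approximate counts, acceptance functionals

Route PneNP/PhaseTwins, support item stmt-PneNP-2723
(`Summit.PneNP.PneNP.Theses.PhaseTwins.PseudorandomTwinsImplyTarget`). Elementary estimates used by
the coin-length-advice distinguisher:

* binary numerals read by `Computability.decodeNat` (least significant bit first, a missing final
  `1` supplied): `2^{|e|} ≤ 2 · decodeNat e` for `e ≠ []` and `decodePosNum l < 2^{|l|+1}` — the LENGTH of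
  the raw answer of an approximate counter determines the estimate up to a factor `4`;
* the threshold octave `⌊log₂ ⌊7t/2⌋⌋` (`Nat.log 2 (7 * t / 2)`): a `(1 + 1/7)`-approximation `d` of a count `n`
  (`IsApproxCount 7 n d`, i.e. `7n ≤ 8d`, `7d ≤ 8n`) has a code of length `≤ ⌊log₂ ⌊7t/2⌋⌋` when
  `1 ≤ n ≤ t` and of length `> ⌊log₂ ⌊7t/2⌋⌋` when `n ≥ 8t` (`length_le_octave_of_approx`,
  `octave_lt_length_of_approx`) — the factor `8` of clause (ii) of the crux absorbs both the
  approximation error `(8/7)²` and the factor-`4` ambiguity of the length;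
* acceptance functionals `Σ' x, D(x) · a(x)` of a `[0,1]`-valued test against a `PMF`: the lower bound
  `c · D(S)` when `a ≥ c` on `S` and the upper bound `c + D(Sᶜ)` when `a ≤ c` on `S`
  (`mul_mass_le_tsum`, `tsum_le_add_mass_compl`);
* tightness in length: every `PMF` on strings puts mass `≤ ε` above some length (`exists_length_tail_le`).

References: S. Aaronson, A. Arkhipov, Theory of Computing 9 (2013), Def. 2.4, Thm. 4.1 (format of
approximate counters); S. Arora, B. Barak, *Computational Complexity*, CUP 2009, §7.1.
-/

set_option linter.dupNamespace false -- `Summit.PneNP.PneNP.…`: summit = sub-problem (D-0017)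

namespace Summit.PneNP.PneNP.Theorems

open Literature.Computability.Complexity Literature.Computability.MetaComplexity
open Summit.PneNP.PneNP.Theorems.PseudorandomTwinsAbove.Negative
open _root_.Computability
open scoped ENNReal

namespace AdviceTest

noncomputable section

/-! ### Binary numerals: the value is determined by the length up to a factor `4` -/

/-- `2^{|l|} ≤ 2 · decodePosNum l`. [folklore] -/
theorem two_pow_length_le_two_mul_decodePosNum :
    ∀ l : List Bool, 2 ^ l.length ≤ 2 * (decodePosNum l : ℕ)
  | [] => by simp [decodePosNum]
  | false :: l => by
    have ih := two_pow_length_le_two_mul_decodePosNum l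
    simp only [decodePosNum, PosNum.cast_bit0, List.length_cons, pow_succ]
    omega
  | true :: l => by
    have ih := two_pow_length_le_two_mul_decodePosNum l
    simp only [decodePosNum, List.length_cons, pow_succ]
    split_ifs with h
    · subst h; simp
    · simp only [PosNum.cast_bit1]
      omega

/-- `decodePosNum l < 2^{|l|+1}`. [folklore] -/
theorem decodePosNum_lt_two_pow : ∀ l : List Bool, (decodePosNum l : ℕ) < 2 ^ (l.length + 1)
  | [] => by simp [decodePosNum]
  | false :: l => by
    have ih := decodePosNum_lt_two_pow l
    simp only [decodePosNum, PosNum.cast_bit0, List.length_cons, pow_succ] at ih ⊢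
    omega
  | true :: l => by
    have ih := decodePosNum_lt_two_pow l
    simp only [decodePosNum, List.length_cons, pow_succ] at ih ⊢
    split_ifs with h
    · subst h; simp
    · simp only [PosNum.cast_bit1]
      omega

/-- A non-empty string read in binary is at least half of `2^{|e|}`. [folklore] -/
theorem two_pow_length_le_two_mul_decodeNat (e : List Bool) (he : e ≠ []) :
    2 ^ e.length ≤ 2 * decodeNat e := by
  unfold decodeNat decodeNum
  rw [if_neg he]
  simpa using two_pow_length_le_two_mul_decodePosNum e

/-! ### Approximate counts at accuracy `1 + 1/7` -/

/-- `IsApproxCount 7 n d` in integers: `7n ≤ 8d` and `7d ≤ 8n`. [folklore] -/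
theorem isApproxCount_seven {n d : ℕ} (h : IsApproxCount 7 n d) : 7 * n ≤ 8 * d ∧ 7 * d ≤ 8 * n := by
  obtain ⟨h1, h2⟩ := h
  have h8 : (1 : ℝ) + 1 / ((7 : ℕ) : ℝ) = 8 / 7 := by norm_num
  rw [h8] at h1 h2
  rw [div_le_iff₀ (by norm_num : (0 : ℝ) < 8 / 7)] at h1
  constructor
  · have : (7 * n : ℝ) ≤ 8 * d := by linarith
    exact_mod_cast this
  · have : (7 * d : ℝ) ≤ 8 * n := by linarith
    exact_mod_cast this

/-- NO side: a `(1+1/7)`-approximation of a count `n ∈ [1, t]`, read off a string `e`, has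
`|e| ≤ ⌊log₂ ⌊7t/2⌋⌋` (the threshold octave). [this work] -/
theorem length_le_octave_of_approx {t n : ℕ} {e : List Bool} (hn : 0 < n) (hnt : n ≤ t)
    (happ : IsApproxCount 7 n (decodeNat e)) : e.length ≤ Nat.log 2 (7 * t / 2) := by
  obtain ⟨h1, h2⟩ := isApproxCount_seven happ
  set d := decodeNat e with hd
  have hdpos : 0 < d := by omega
  have he : e ≠ [] := by
    intro he0
    rw [he0] at hd
    simp [decodeNat, decodeNum] at hd
    omega
  have hpow := two_pow_length_le_two_mul_decodeNat e he
  rw [← hd] at hpow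
  set m := 7 * t / 2 with hm
  have hm7 : 7 * t ≤ 2 * m + 1 := by omega
  set s := Nat.log 2 m with hs
  have hlt : m < 2 ^ (s + 1) := Nat.lt_pow_succ_log_self (by norm_num) m
  have e1 : 2 ^ (s + 1) = 2 * 2 ^ s := by rw [pow_succ]; ring
  by_contra hL
  have hL' : s + 1 ≤ e.length := by omega
  have hmono : 2 ^ (s + 1) ≤ 2 ^ e.length := Nat.pow_le_pow_right (by norm_num) hL'
  omega

/-- YES side: a `(1+1/7)`-approximation of a count `n ≥ 8t` with `t ≥ 1`, read off a string `e`,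
has `|e| > ⌊log₂ ⌊7t/2⌋⌋`. [this work] -/
theorem octave_lt_length_of_approx {t n : ℕ} {e : List Bool} (ht : 0 < t) (hnt : 8 * t ≤ n)
    (happ : IsApproxCount 7 n (decodeNat e)) : Nat.log 2 (7 * t / 2) < e.length := by
  obtain ⟨h1, -⟩ := isApproxCount_seven happ
  -- `decodeNat e < 2^{|e|+1}` (also `Cryptography.decodeNat_lt` in `ShorFactoring.lean`, not imported)
  have hup : decodeNat e < 2 ^ (e.length + 1) := by
    unfold decodeNat decodeNum
    split_ifs with he
    · subst he; simp
    · simpa using decodePosNum_lt_two_pow e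
  set d := decodeNat e with hd
  set m := 7 * t / 2 with hm
  have hm0 : m ≠ 0 := by omega
  set s := Nat.log 2 m with hs
  have hle : 2 ^ s ≤ m := Nat.pow_log_le_self 2 hm0
  have e1 : 2 ^ (e.length + 1) = 2 * 2 ^ e.length := by rw [pow_succ]; ring
  by_contra hL
  have hL' : e.length ≤ s := by omega
  have hmono : 2 ^ e.length ≤ 2 ^ s := Nat.pow_le_pow_right (by norm_num) hL'
  omega

/-! ### Counting probabilities -/

/-- Complement bound: if `Pr[¬ G] ≤ δ` and `G ⟹ A` on strings of length `m`, then `Pr[A] ≥ 1 - δ`.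
[folklore] -/
theorem one_sub_le_uniformProb {m : ℕ} {G A : Set (List Bool)} {δ : ℝ}
    (hG : uniformProb m {u | u ∉ G} ≤ δ) (h : ∀ y : List Bool, y.length = m → y ∈ G → y ∈ A) :
    1 - δ ≤ uniformProb m A := by
  classical
  have hc : uniformProb m Gᶜ = 1 - uniformProb m G := uniformProb_compl m G
  have hmono : uniformProb m G ≤ uniformProb m A := by
    unfold uniformProb
    refine div_le_div_of_nonneg_right ?_ (by positivity)
    exact_mod_cast Finset.card_le_card fun (v : List.Vector Bool m) hv => by
      simp only [Finset.mem_filter, Finset.mem_univ, true_and] at hv ⊢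
      exact h v.toList v.toList_length hv
  change uniformProb m Gᶜ ≤ δ at hG
  linarith

/-- Dual bound: if `Pr[¬ G] ≤ δ` and `A ⟹ ¬ G` on strings of length `m`, then `Pr[A] ≤ δ`. [folklore] -/
theorem uniformProb_le_of_subset_compl {m : ℕ} {G A : Set (List Bool)} {δ : ℝ}
    (hG : uniformProb m {u | u ∉ G} ≤ δ) (h : ∀ y : List Bool, y.length = m → y ∈ A → y ∉ G) :
    uniformProb m A ≤ δ := by
  classical
  refine le_trans ?_ hG
  unfold uniformProb
  refine div_le_div_of_nonneg_right ?_ (by positivity)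
  exact_mod_cast Finset.card_le_card fun (v : List.Vector Bool m) hv => by
    simp only [Finset.mem_filter, Finset.mem_univ, true_and] at hv ⊢
    exact h v.toList v.toList_length hv

/-! ### Acceptance functionals against a `PMF` -/

variable {X : Type*}

/-- A bounded test functional is summable against a `PMF`. [folklore] -/
theorem summable_mul_of_le (D : PMF X) {a : X → ℝ} {C : ℝ} (ha0 : ∀ x, 0 ≤ a x)
    (ha1 : ∀ x, a x ≤ C) : Summable fun x => (D x).toReal * a x := by
  have hsum : Summable fun x => (D x).toReal :=
    ENNReal.summable_toReal (by rw [D.tsum_coe]; exact ENNReal.one_ne_top)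
  refine Summable.of_nonneg_of_le (fun x => mul_nonneg ENNReal.toReal_nonneg (ha0 x))
    (fun x => ?_) (hsum.mul_right C)
  exact mul_le_mul_of_nonneg_left (ha1 x) ENNReal.toReal_nonneg

/-- The functional of a scaled indicator is the scaled mass. [folklore] -/
theorem tsum_mul_ite_eq (D : PMF X) (S : Set X) [DecidablePred (· ∈ S)] (c : ℝ) :
    ∑' x, (D x).toReal * (if x ∈ S then c else 0) = c * (D.toOuterMeasure S).toReal := by
  have h1 : ∀ x, (D x).toReal * (if x ∈ S then c else 0) = c * (S.indicator (fun x => (D x).toReal) x) := by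
    intro x
    by_cases hx : x ∈ S
    · simp [hx, mul_comm]
    · simp [hx]
  simp_rw [h1]
  rw [tsum_mul_left, PMF.toOuterMeasure_apply, ENNReal.tsum_toReal_eq (fun x => ?_)]
  · congr 1
    refine tsum_congr fun x => ?_
    by_cases hx : x ∈ S <;> simp [hx]
  · exact ((Set.indicator_le_self S D x).trans_lt (PMF.apply_lt_top D x)).ne

/-- **Lower bound on an acceptance functional**: if the test value is `≥ c ≥ 0` on `S` (and `≥ 0`,
`≤ 1` everywhere) then `Σ' x, D(x) · a(x) ≥ c · D(S)`. [folklore] -/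
theorem mul_mass_le_tsum (D : PMF X) {a : X → ℝ} (S : Set X) {c : ℝ} (ha0 : ∀ x, 0 ≤ a x)
    (ha1 : ∀ x, a x ≤ 1) (hc : 0 ≤ c) (hS : ∀ x ∈ S, c ≤ a x) :
    c * (D.toOuterMeasure S).toReal ≤ ∑' x, (D x).toReal * a x := by
  classical
  rw [← tsum_mul_ite_eq D S c]
  refine Summable.tsum_le_tsum (fun x => ?_) ?_ (summable_mul_of_le D ha0 ha1)
  · refine mul_le_mul_of_nonneg_left ?_ ENNReal.toReal_nonneg
    split_ifs with hx
    · exact hS x hx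
    · exact ha0 x
  · exact summable_mul_of_le D (C := c) (fun x => by split_ifs <;> simp [hc])
      (fun x => by split_ifs <;> simp [hc])

/-- **Upper bound on an acceptance functional**: if the test value is `≤ c` on `S` (and in `[0,1]`
everywhere, `c ≥ 0`) then `Σ' x, D(x) · a(x) ≤ c + D(Sᶜ)`. [folklore] -/
theorem tsum_le_add_mass_compl (D : PMF X) {a : X → ℝ} (S : Set X) {c : ℝ} (ha0 : ∀ x, 0 ≤ a x)
    (ha1 : ∀ x, a x ≤ 1) (hc : 0 ≤ c) (hS : ∀ x ∈ S, a x ≤ c) :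
    ∑' x, (D x).toReal * a x ≤ c + (D.toOuterMeasure Sᶜ).toReal := by
  classical
  have hpt : ∀ x, (D x).toReal * a x ≤
      (D x).toReal * c + (D x).toReal * (if x ∈ Sᶜ then (1 : ℝ) else 0) := by
    intro x
    rw [← mul_add]
    refine mul_le_mul_of_nonneg_left ?_ ENNReal.toReal_nonneg
    by_cases hx : x ∈ S
    · have : x ∉ Sᶜ := fun h => h hx
      simp only [this, if_false, add_zero]
      exact hS x hx
    · have : x ∈ Sᶜ := hx
      simp only [this, if_true]
      linarith [ha1 x]
  have hsum : Summable fun x => (D x).toReal :=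
    ENNReal.summable_toReal (by rw [D.tsum_coe]; exact ENNReal.one_ne_top)
  have hone : ∑' x, (D x).toReal = 1 := by
    rw [← ENNReal.tsum_toReal_eq (fun x => PMF.apply_ne_top D x), D.tsum_coe, ENNReal.toReal_one]
  have hs1 : Summable fun x => (D x).toReal * c := hsum.mul_right c
  have hs2 : Summable fun x => (D x).toReal * (if x ∈ Sᶜ then (1 : ℝ) else 0) :=
    summable_mul_of_le D (C := 1) (fun x => by split_ifs <;> simp) (fun x => by split_ifs <;> simp)
  calc ∑' x, (D x).toReal * a x
      ≤ ∑' x, ((D x).toReal * c + (D x).toReal * (if x ∈ Sᶜ then (1 : ℝ) else 0)) :=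
        Summable.tsum_le_tsum hpt (summable_mul_of_le D ha0 ha1) (hs1.add hs2)
    _ = ∑' x, (D x).toReal * c + ∑' x, (D x).toReal * (if x ∈ Sᶜ then (1 : ℝ) else 0) :=
        hs1.tsum_add hs2
    _ = c + (D.toOuterMeasure Sᶜ).toReal := by
        rw [tsum_mul_right, hone, one_mul, tsum_mul_ite_eq, one_mul]

/-! ### Tightness in length -/

/-- Every distribution on strings puts mass at most `ε` on the strings longer than some `L`, which
may be taken beyond any prescribed `L₀`. [folklore] -/
theorem exists_length_tail_le (D : PMF (List Bool)) {ε : ℝ} (hε : 0 < ε) (L₀ : ℕ) :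
    ∃ L, L₀ < L ∧ (D.toOuterMeasure {x | L < x.length}).toReal ≤ ε := by
  obtain ⟨E, hE⟩ := exists_finset_mass_compl_le D hε
  refine ⟨max (E.sup List.length) L₀ + 1, by omega, (mass_mono D ?_).trans hE⟩
  intro x hx hxE
  have h1 : x.length ≤ E.sup List.length := Finset.le_sup (f := List.length) hxE
  change max (E.sup List.length) L₀ + 1 < x.length at hx
  omega

end

end AdviceTest

end Summit.PneNP.PneNP.Theorems
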